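import Literature.NumberTheory.GaloisRepresentations.LocalFieldInertiaCdOne
import Literature.NumberTheory.GaloisRepresentations.CyclicQuotientTwoCocycle
import Literature.NumberTheory.GaloisRepresentations.WeilGroupDensityProofs
import Literature.NumberTheory.GaloisRepresentations.CohomologicalDimensionProofs
import HarnessLib

/-!
# `cd_p(Γ_F) ≤ 2` for a non-archimedean local field `F` of characteristic `0` (Serre II §4.3 Prop. 12)

Topic `NumberTheory/GaloisRepresentations`; namespace `Literature.NumberTheory.GaloisRepresentations`.
Theorems only (no definition, no named fact; D-0026).

Let `F` be a non-archimedean local field of characteristic `0`, `Γ_F = Gal(F̄/F)`,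
`N = Gal(F̄/F^nr) ⊴ Γ_F` (`galUnr F`, `LocalFieldInertiaCdOne`).  Serre, *Cohomologie galoisienne*
II §4.3 Prop. 12: **`cd_p(Γ_F) = 2` for every prime `p`** (`p ≠ char F`).  We prove the upper bound

* `groupCdLE_two_absoluteGaloisGroup` — **`cd_p(Γ_F) ≤ 2`** (`GroupCdLE`), i.e. (`fieldCdLE_two`)
  `cd_p(F) ≤ 2`; and its consequences `subsingleton_continuousCohomology_of_two_lt`
  (**`H^q(Γ_F, M) = 0` for `q ≥ 3`** and every discrete `p`-primary torsion `Γ_F`-module `M`) and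
  `groupCdLE_two_of_isClosed` (the same for every closed subgroup, e.g. `Gal(F̄/E)`).

Proof (Serre, loc. cit.): the tower theorem `cd_p(Γ_F) ≤ cd_p(N) + cd_p(Γ_F/N)`
(`tower_groupCdLE_of_isClosed_normal_holds`) with `cd_p(N) ≤ 1` (`groupCdLE_one_galUnr`,
`LocalFieldInertiaCdOne`) and **`cd_p(Γ_F/N) ≤ 1`** (`groupCdLE_one_quotient_galUnr`): the profinite
group `Γ_F/N = Gal(F^nr/F) ≅ Ẑ` is topologically generated by the Frobenius — every finite
quotient `Γ_F/U`, `U ⊇ N` open normal, is cyclic generated by the image of an arithmetic Frobenius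
`φ` (`exists_pow_eq_mk`: density of the Weil group, `WeilGroup.denseRange_toAbsGalois_holds`, and
`σ φ^{-deg σ} ∈ I_F ≤ N` for `σ` in the Weil group) — so a continuous `2`-cocycle with finite
`p`-primary coefficients, inflated from a finite level `Γ_F/U`, dies after inflation to the level
`U ∩ Gal(F̄/F_m)` for `m` a multiple of `#B · [Γ_F : U]` (explicit coboundary of
`CyclicQuotientTwoCocycle`: `twoCocycleClass_eq_zero_of_cyclicQuotient`, `frobSum_eq_zero_of_dvd`).
(The lower bound `cd_p(Γ_F) ≥ 2` is `H²(Γ_F, μ_p) = Br(F)[p] ≠ 0`, `LocalCorInjective.natCard_two_mu_eq`;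
it is not restated here.)

## References
* J.-P. Serre, *Cohomologie galoisienne* / *Galois Cohomology* (1997), II §4.3 Prop. 12; I §3.3
  Prop. 15 (tower); XIII §1 of *Corps locaux* (cohomology of `Ẑ`). [SerreGaloisCohomology1997]
* J. Tate, *Number theoretic background*, Corvallis 1979, (1.4.1) (`W_F` dense in `Γ_F`). [Corvallis1979]
-/

noncomputable section

open scoped Pointwise
open CategoryTheory Function
open Field IsNonarchimedeanLocalField ValuativeRel IntermediateField

universe u

namespace Literature.NumberTheory.GaloisRepresentations

open _root_.TopRep _root_.ContRepresentation _root_.ContinuousCohomology DiscreteGaloisModule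
open _root_.Topology _root_.Filter
open LocalWeilDatum

section Local

variable (F : Type u) [Field F] [ValuativeRel F] [TopologicalSpace F] [IsNonarchimedeanLocalField F]

/-! ### Frobenius generates the finite unramified quotients -/

/-- Powers of an arithmetic Frobenius are Frobenius powers: `IsFrobPow (φ ^ k) k`. [folklore] -/
theorem isFrobPow_pow {φ : absoluteGaloisGroup F} (hφ : IsFrobPow φ 1) : ∀ k : ℕ, IsFrobPow (φ ^ k) (k : ℤ)
  | 0 => by rw [pow_zero]; exact IsFrobPow.one
  | k + 1 => by
    rw [pow_succ, Nat.cast_succ]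
    exact IsFrobPow.mul_holds (isFrobPow_pow hφ k) hφ

/-- In a group, `a b⁻¹ ∈ U` for a normal `U` gives equal cosets `a U = b U`. [folklore] -/
theorem quotientGroup_mk_eq_of_mul_inv_mem {G : Type*} [Group G] {U : Subgroup G} [U.Normal]
    {a b : G} (h : a * b⁻¹ ∈ U) : (QuotientGroup.mk a : G ⧸ U) = QuotientGroup.mk b := by
  rw [QuotientGroup.eq]
  have h1 : b⁻¹ * a ∈ U := Subgroup.Normal.mem_comm inferInstance h
  have h2 := U.inv_mem h1
  rwa [mul_inv_rev, inv_inv] at h2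

/-- In a finite group, an inverse is a positive power. [folklore] -/
theorem exists_pow_eq_inv {G : Type*} [Group G] [Finite G] (x : G) : ∃ j : ℕ, x⁻¹ = x ^ j := by
  refine ⟨orderOf x - 1, ?_⟩
  have ho : 0 < orderOf x := orderOf_pos x
  symm
  apply eq_inv_of_mul_eq_one_left
  rw [← pow_succ, Nat.sub_add_cancel ho, pow_orderOf_eq_one]

/-- **Frobenius generates `Γ_F/U` for every open normal `U ⊇ I_F`** (`I_F = absInertia F` the
inertia group): every coset is `φⁱ U` for an arithmetic Frobenius `φ`.  Proof: the coset `σU`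
meets the dense Weil group (`WeilGroup.denseRange_toAbsGalois_holds`) in some `w` of degree
`n ∈ ℤ`, and `w φ^{-n} ∈ I_F ≤ U`. [cite: Corvallis1979, (1.4.1)] [cite: SerreLocalFields1979, IV §4] -/
theorem exists_pow_eq_mk {U : Subgroup (absoluteGaloisGroup F)} [U.Normal]
    (hU : IsOpen (U : Set (absoluteGaloisGroup F))) (hIU : absInertia F ≤ U)
    {φ : absoluteGaloisGroup F} (hφ : IsFrobPow φ 1) (q : absoluteGaloisGroup F ⧸ U) :
    ∃ i : ℕ, q = (QuotientGroup.mk φ : absoluteGaloisGroup F ⧸ U) ^ i := by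
  haveI := absoluteGaloisGroup_compactSpace F
  haveI : Finite (absoluteGaloisGroup F ⧸ U) := Subgroup.quotient_finite_of_isOpen U hU
  obtain ⟨σ, rfl⟩ := QuotientGroup.mk_surjective q
  -- a Weil element in `σ U`
  have hopen : IsOpen (σ • (U : Set (absoluteGaloisGroup F))) := hU.smul σ
  have hne : (σ • (U : Set (absoluteGaloisGroup F))).Nonempty :=
    ⟨σ, Set.mem_smul_set.2 ⟨1, U.one_mem, by rw [smul_eq_mul, mul_one]⟩⟩
  obtain ⟨w, hw⟩ := (WeilGroup.denseRange_toAbsGalois_holds (F := F)).exists_mem_open hopen hne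
  obtain ⟨u, hu, hσu⟩ := Set.mem_smul_set.1 hw
  set v : absoluteGaloisGroup F := WeilGroup.toAbsGalois F w with hvdef
  have hσv : (QuotientGroup.mk σ : absoluteGaloisGroup F ⧸ U) = QuotientGroup.mk v := by
    rw [QuotientGroup.eq, ← hσu, smul_eq_mul, inv_mul_cancel_left]
    exact hu
  rw [hσv]
  -- `v` is a Frobenius power of some integral exponent
  obtain ⟨n, hn⟩ := WeilGroup.exists_isFrobPow_toAbsGalois IsFrobPow.mul_holds w
  rw [← hvdef] at hn
  -- positive exponent: `v φ^{-k} ∈ I_F ≤ U`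
  have key : ∀ (x : absoluteGaloisGroup F) (k : ℕ), IsFrobPow x (k : ℤ) →
      (QuotientGroup.mk x : absoluteGaloisGroup F ⧸ U) = (QuotientGroup.mk φ) ^ k := by
    intro x k hx
    rw [← QuotientGroup.mk_pow]
    apply quotientGroup_mk_eq_of_mul_inv_mem
    exact hIU (IsFrobPow.mul_inv_mem_absInertia_holds hx (isFrobPow_pow F hφ k))
  rcases Int.eq_nat_or_neg n with ⟨k, rfl | rfl⟩
  · exact ⟨k, key v k hn⟩
  · -- negative exponent: `v⁻¹` has exponent `k`, and inverses are positive powers in the finite quotient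
    have hinv : IsFrobPow v⁻¹ (k : ℤ) := by
      have := hn.inv
      rwa [neg_neg] at this
    have h1 : (QuotientGroup.mk v⁻¹ : absoluteGaloisGroup F ⧸ U) = (QuotientGroup.mk φ) ^ k := key _ k hinv
    obtain ⟨j, hj⟩ := exists_pow_eq_inv ((QuotientGroup.mk φ : absoluteGaloisGroup F ⧸ U) ^ k)
    refine ⟨k * j, ?_⟩
    rw [pow_mul, ← hj, ← h1, QuotientGroup.mk_inv, inv_inv]

/-- **Frobenius generates the finite quotients of `Γ_F/N`**: for an open normal `H ≤ Γ_F/N`, every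
coset of `(Γ_F/N)/H` is a power of the image of an arithmetic Frobenius.
[cite: Corvallis1979, (1.4.1)] [cite: SerreLocalFields1979, IV §4] -/
theorem exists_pow_eq_mk_quotient (H : Subgroup (absoluteGaloisGroup F ⧸ galUnr F)) [H.Normal]
    (hH : IsOpen (H : Set (absoluteGaloisGroup F ⧸ galUnr F)))
    {φ : absoluteGaloisGroup F} (hφ : IsFrobPow φ 1) (r : (absoluteGaloisGroup F ⧸ galUnr F) ⧸ H) :
    ∃ i : ℕ, r = (QuotientGroup.mk (QuotientGroup.mk φ : absoluteGaloisGroup F ⧸ galUnr F) : _ ⧸ H) ^ i := by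
  let U : Subgroup (absoluteGaloisGroup F) := H.comap (QuotientGroup.mk' (galUnr F))
  haveI : U.Normal := Subgroup.Normal.comap inferInstance _
  have hUo : IsOpen (U : Set (absoluteGaloisGroup F)) := hH.preimage continuous_quot_mk
  have hNU : galUnr F ≤ U := by
    intro x hx
    rw [Subgroup.mem_comap, QuotientGroup.mk'_apply, (QuotientGroup.eq_one_iff x).2 hx]
    exact one_mem H
  obtain ⟨q, rfl⟩ := QuotientGroup.mk_surjective r
  obtain ⟨σ, rfl⟩ := QuotientGroup.mk_surjective q
  obtain ⟨i, hi⟩ := exists_pow_eq_mk F hUo ((absInertia_le_galUnr F).trans hNU) hφ (QuotientGroup.mk σ)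
  refine ⟨i, ?_⟩
  rw [← QuotientGroup.mk_pow, ← QuotientGroup.mk_pow, QuotientGroup.eq]
  rw [← QuotientGroup.mk_pow, QuotientGroup.eq] at hi
  -- `σ⁻¹ φⁱ ∈ U` means its image lies in `H`
  have h := Subgroup.mem_comap.1 hi
  rwa [QuotientGroup.mk'_apply, QuotientGroup.mk_mul, QuotientGroup.mk_inv] at h

/-! ### `cd_p(Γ_F/N) ≤ 1` -/

/-- **`H²(Γ_F/N, B) = 0` for every finite discrete `Γ_F/N`-module `B`** (`N = Gal(F̄/F^nr)`): a
continuous `2`-cocycle is inflated from a finite cyclic quotient generated by the Frobenius, and dies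
after inflation to a deeper unramified level (`twoCocycleClass_eq_zero_of_cyclicQuotient`,
`frobSum_eq_zero_of_dvd`). [cite: SerreGaloisCohomology1997, II §4.3 Prop. 12 (proof: `cd(Ẑ) = 1`)]
[cite: SerreLocalFields1979, XIII §1] -/
theorem subsingleton_two_quotient_galUnr_of_finite
    (B : Type u) [AddCommGroup B] [TopologicalSpace B] [DiscreteTopology B] [Finite B]
    (τ : ContinuousRep (absoluteGaloisGroup F ⧸ galUnr F) ℤ B) :
    Subsingleton (continuousCohomology 2 τ.toTopRep) := by
  classical
  haveI := absoluteGaloisGroup_compactSpace F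
  set Q := absoluteGaloisGroup F ⧸ galUnr F
  let π : absoluteGaloisGroup F →ₜ* Q := ⟨QuotientGroup.mk' (galUnr F), continuous_quot_mk⟩
  -- an arithmetic Frobenius
  obtain ⟨φ, hφ⟩ := exists_isFrobPow_holds (F := F) 1
  refine subsingleton_of_forall_eq 0 fun x => ?_
  obtain ⟨z, rfl⟩ := twoCocycleClass_surjective _ x
  -- the pulled-back action and its (open) kernel
  let τΓ : ContinuousRep (absoluteGaloisGroup F) ℤ B := τ.restrict π
  have hker : (⋂ b : B, {σ : absoluteGaloisGroup F | τΓ σ b = b}) ∈ 𝓝 (1 : absoluteGaloisGroup F) :=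
    (Filter.iInter_mem).2 fun b => τΓ.setOf_apply_eq_mem_nhds_one b
  -- uniform local constancy of `z ∘ (π × π)` on `Γ × Γ`
  obtain ⟨V, hV, hVz⟩ := exists_nhds_one_forall_eq' (X := absoluteGaloisGroup F × absoluteGaloisGroup F)
    (P := absoluteGaloisGroup F × absoluteGaloisGroup F)
    (fun a v => z.1 (π (a * v).1, π (a * v).2))
    ((z.1.continuous.comp ((π.continuous.comp continuous_fst).prodMk (π.continuous.comp continuous_snd))).comp
      continuous_mul)
  obtain ⟨V₁, hV₁, V₂, hV₂, hV₁₂⟩ := mem_nhds_prod_iff.1 hV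
  have h1 : (1 : absoluteGaloisGroup F) ∈ interior ((⋂ b : B, {σ : absoluteGaloisGroup F | τΓ σ b = b}) ∩ (V₁ ∩ V₂)) :=
    mem_interior_iff_mem_nhds.2 (inter_mem hker (inter_mem hV₁ hV₂))
  obtain ⟨W, hW⟩ := ProfiniteGrp.exist_openNormalSubgroup_sub_open_nhds_of_one isOpen_interior h1
  have hW' : (W : Set (absoluteGaloisGroup F)) ⊆ (⋂ b : B, {σ | τΓ σ b = b}) ∩ (V₁ ∩ V₂) :=
    hW.trans interior_subset
  have h1V₁ : (1 : absoluteGaloisGroup F) ∈ V₁ := mem_of_mem_nhds hV₁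
  have h1V₂ : (1 : absoluteGaloisGroup F) ∈ V₂ := mem_of_mem_nhds hV₂
  -- the open normal subgroup `H₀ = π(W)` of `Q`
  let H₀ : Subgroup Q := (W : Subgroup (absoluteGaloisGroup F)).map (QuotientGroup.mk' (galUnr F))
  haveI : H₀.Normal := Subgroup.Normal.map inferInstance _ (QuotientGroup.mk'_surjective _)
  have hH₀o : IsOpen (H₀ : Set Q) := by
    change IsOpen ((QuotientGroup.mk' (galUnr F)) '' ((W : Subgroup (absoluteGaloisGroup F)) : Set (absoluteGaloisGroup F)))
    exact QuotientGroup.isOpenMap_coe ((W : Subgroup (absoluteGaloisGroup F)) : Set (absoluteGaloisGroup F)) W.isOpen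
  -- right invariance of `z` and triviality of the action on `H₀`
  have hz₁ : ∀ (a b : Q), ∀ h ∈ H₀, z.1 (a * h, b) = z.1 (a, b) := by
    intro a b h hh
    obtain ⟨σ, rfl⟩ := QuotientGroup.mk_surjective a
    obtain ⟨ρ', rfl⟩ := QuotientGroup.mk_surjective b
    obtain ⟨w, hw, rfl⟩ := hh
    have hmem : ((w, 1) : absoluteGaloisGroup F × absoluteGaloisGroup F) ∈ V :=
      hV₁₂ (Set.mk_mem_prod (hW' hw).2.1 h1V₂)
    have h : z.1 (π (σ * w), π (ρ' * 1)) = z.1 (π (σ * 1), π (ρ' * 1)) := hVz (σ, ρ') (w, 1) hmem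
    rw [mul_one, mul_one, map_mul] at h
    exact h
  have hz₂ : ∀ (a b : Q), ∀ h ∈ H₀, z.1 (a, b * h) = z.1 (a, b) := by
    intro a b h hh
    obtain ⟨σ, rfl⟩ := QuotientGroup.mk_surjective a
    obtain ⟨ρ', rfl⟩ := QuotientGroup.mk_surjective b
    obtain ⟨w, hw, rfl⟩ := hh
    have hmem : ((1, w) : absoluteGaloisGroup F × absoluteGaloisGroup F) ∈ V :=
      hV₁₂ (Set.mk_mem_prod h1V₁ (hW' hw).2.2)
    have h : z.1 (π (σ * 1), π (ρ' * w)) = z.1 (π (σ * 1), π (ρ' * 1)) := hVz (σ, ρ') (1, w) hmem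
    rw [mul_one, mul_one, map_mul] at h
    exact h
  have hHX : ∀ h ∈ H₀, ∀ b : B, τ.toTopRep.ρ h b = b := by
    intro h hh b
    obtain ⟨w, hw, rfl⟩ := hh
    rw [ContinuousRep.toTopRep_ρ_apply]
    exact Set.mem_iInter.1 (hW' hw).1 b
  -- the period `n₀` of the Frobenius modulo `H₀`, and the deeper level `H₁ = H₀ ∩ π(Gal(F̄/F_m))`
  haveI : Finite (Q ⧸ H₀) := Subgroup.quotient_finite_of_isOpen H₀ hH₀o
  set φQ : Q := QuotientGroup.mk φ with hφQ
  set n₀ : ℕ := orderOf (QuotientGroup.mk φQ : Q ⧸ H₀) with hn₀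
  have hn₀pos : 0 < n₀ := orderOf_pos _
  set m : ℕ := Nat.card B * n₀ with hmdef
  have hm : 0 < m := Nat.mul_pos Nat.card_pos hn₀pos
  haveI := (unramifiedLevel_finite_abelian_unramified F hm).1
  haveI := (unramifiedLevel_finite_abelian_unramified F hm).2.1
  haveI : (galFixing F (unramifiedLevel F m)).Normal := normal_galFixing _
  let H₁ : Subgroup Q := H₀ ⊓ (galFixing F (unramifiedLevel F m)).map (QuotientGroup.mk' (galUnr F))
  haveI : ((galFixing F (unramifiedLevel F m)).map (QuotientGroup.mk' (galUnr F))).Normal :=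
    Subgroup.Normal.map inferInstance _ (QuotientGroup.mk'_surjective _)
  haveI : H₁.Normal := inferInstance
  have hH₁o : IsOpen (H₁ : Set Q) := by
    change IsOpen ((H₀ : Set Q) ∩ ((QuotientGroup.mk' (galUnr F)) '' (galFixing F (unramifiedLevel F m) : Set _)))
    exact hH₀o.inter (QuotientGroup.isOpenMap_coe _ (isOpen_galFixing F _))
  have hH₁₀ : H₁ ≤ H₀ := inf_le_left
  haveI : Finite (Q ⧸ H₁) := Subgroup.quotient_finite_of_isOpen H₁ hH₁o
  set n₁ : ℕ := orderOf (QuotientGroup.mk φQ : Q ⧸ H₁) with hn₁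
  -- `φ^{n₁} ∈ Gal(F̄/F_m)`, hence `m ∣ n₁`
  have hpow₁ : φQ ^ n₁ ∈ H₁ := by
    rw [← QuotientGroup.eq_one_iff, QuotientGroup.mk_pow, hn₁]
    exact pow_orderOf_eq_one _
  have hφm : φ ^ n₁ ∈ galFixing F (unramifiedLevel F m) := by
    have h2 : (QuotientGroup.mk (φ ^ n₁) : Q) ∈ (galFixing F (unramifiedLevel F m)).map (QuotientGroup.mk' (galUnr F)) := by
      have := hpow₁.2
      rwa [hφQ, ← QuotientGroup.mk_pow] at this
    have h3 : φ ^ n₁ ∈ ((galFixing F (unramifiedLevel F m)).map (QuotientGroup.mk' (galUnr F))).comap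
        (QuotientGroup.mk' (galUnr F)) := h2
    rw [Subgroup.comap_map_eq, QuotientGroup.ker_mk',
      sup_eq_left.2 (galUnr_le_galFixing_unramifiedLevel F hm)] at h3
    exact h3
  have hmn₁ : m ∣ n₁ := by
    have hfix : (φ ^ n₁) • rootOfUnramifiedLevel F m = rootOfUnramifiedLevel F m :=
      (mem_galFixing_iff F).1 hφm _ (IntermediateField.mem_adjoin_simple_self F _)
    exact (smul_eq_self_iff_dvd_of_isFrobPow F hm (isPrimitiveRoot_rootOfUnramifiedLevel F hm)
      (isFrobPow_pow F hφ n₁)).1 hfix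
  -- `n₀ ∣ n₁`
  have hn₀₁ : n₀ ∣ n₁ := by
    rw [hn₀]
    apply orderOf_dvd_of_pow_eq_one
    rw [← QuotientGroup.mk_pow, QuotientGroup.eq_one_iff]
    exact hH₁₀ hpow₁
  obtain ⟨k, hk⟩ := hn₀₁
  have hNk : Nat.card B ∣ k := by
    have h := hmn₁
    rw [hk, hmdef, mul_comm (Nat.card B) n₀] at h
    exact Nat.dvd_of_mul_dvd_mul_left hn₀pos h
  -- the norm sum over one period modulo `H₁` vanishes
  have hsum : frobSum z φQ (orderOf (QuotientGroup.mk φQ : Q ⧸ H₁)) = 0 := by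
    rw [← hn₁, hk]
    refine frobSum_eq_zero_of_dvd (H₀ := H₀) hz₁ ?_ (fun b : B => card_nsmul_eq_zero') hNk
    rw [← QuotientGroup.eq_one_iff, QuotientGroup.mk_pow, hn₀]
    exact pow_orderOf_eq_one _
  -- conclude with the explicit coboundary of `CyclicQuotientTwoCocycle`
  exact twoCocycleClass_eq_zero_of_cyclicQuotient H₁ φQ z (exists_pow_eq_mk_quotient F H₁ hH₁o hφ) hH₁o
    (fun a b h hh => hz₁ a b h (hH₁₀ hh)) (fun a b h hh => hz₂ a b h (hH₁₀ hh))
    (fun h hh b => hHX h (hH₁₀ hh) b) hsum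

/-- **`cd_p(Γ_F/N) ≤ 1` for every prime `p`**, `N = Gal(F̄/F^nr)` (`Γ_F/N = Gal(F^nr/F) ≅ Ẑ`).
[cite: SerreGaloisCohomology1997, II §4.3 Prop. 12 (proof)] -/
theorem groupCdLE_one_quotient_galUnr (p : ℕ) [hp : Fact p.Prime] :
    GroupCdLE (absoluteGaloisGroup F ⧸ galUnr F) p 1 := by
  haveI := absoluteGaloisGroup_compactSpace F
  exact groupCdLE_one_of_forall_subsingleton_two fun M _ _ _ ρ hM =>
    subsingleton_of_forall_finite ρ hp.out.ne_zero 1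
      (fun B _ _ _ _ τ _ => subsingleton_two_quotient_galUnr_of_finite F B τ) hM

/-! ### `cd_p(Γ_F) ≤ 2` and consequences -/

variable [CharZero F]

/-- **Serre II §4.3 Prop. 12 (upper bound): `cd_p(Gal(F̄/F)) ≤ 2`** for a non-archimedean local
field `F` of characteristic `0` and every prime `p`: tower theorem over `N = Gal(F̄/F^nr)` with
`cd_p(N) ≤ 1` and `cd_p(Γ_F/N) ≤ 1`. [cite: SerreGaloisCohomology1997, II §4.3 Prop. 12] -/
theorem groupCdLE_two_absoluteGaloisGroup (p : ℕ) [Fact p.Prime] :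
    GroupCdLE (absoluteGaloisGroup F) p 2 := by
  haveI := absoluteGaloisGroup_compactSpace F
  exact tower_groupCdLE_of_isClosed_normal_holds (absoluteGaloisGroup F) (galUnr F) (isClosed_galUnr F)
    p 1 1 (groupCdLE_one_galUnr F p) (groupCdLE_one_quotient_galUnr F p)

/-- **`cd_p(F) ≤ 2`** for a non-archimedean local field `F` of characteristic `0`
(`FieldCdLE`, Serre II §4.3 Prop. 12). [cite: SerreGaloisCohomology1997, II §4.3 Prop. 12] -/
theorem fieldCdLE_two (p : ℕ) [Fact p.Prime] : FieldCdLE F p 2 :=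
  groupCdLE_two_absoluteGaloisGroup F p

/-- **`H^q(Γ_F, M) = 0` for `q ≥ 3`** and every discrete `p`-primary torsion `Γ_F`-module `M`
(`F` non-archimedean local of characteristic `0`, `p` prime). [cite: SerreGaloisCohomology1997, II §4.3 Prop. 12] -/
theorem subsingleton_continuousCohomology_of_two_lt {p : ℕ} [Fact p.Prime]
    {M : Type u} [AddCommGroup M] [TopologicalSpace M] [DiscreteTopology M]
    (ρ : ContinuousRep (absoluteGaloisGroup F) ℤ M) (hM : IsPrimaryTorsion p M) {q : ℕ} (hq : 2 < q) :
    Subsingleton (continuousCohomology q ρ.toTopRep) :=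
  groupCdLE_two_absoluteGaloisGroup F p M ρ hM hq

/-- **`cd_p(S) ≤ 2` for every closed subgroup `S ≤ Γ_F`** (e.g. `S = Gal(F̄/E)` for an algebraic
`E/F`), by Serre I §3.3 Prop. 14 (`groupCdLE_subgroup_of_isClosed_holds`).
[cite: SerreGaloisCohomology1997, II §4.3 Prop. 12 and I §3.3 Prop. 14] -/
theorem groupCdLE_two_of_isClosed (S : Subgroup (absoluteGaloisGroup F)) (hS : IsClosed (S : Set (absoluteGaloisGroup F)))
    (p : ℕ) [Fact p.Prime] : GroupCdLE S p 2 := by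
  haveI := absoluteGaloisGroup_compactSpace F
  exact groupCdLE_subgroup_of_isClosed_holds (absoluteGaloisGroup F) S hS p 2
    (groupCdLE_two_absoluteGaloisGroup F p)

/-- **`H^q(Gal(F̄/E), M) = 0` for `q ≥ 3`**, `E ⊆ F̄` any subextension, `M` discrete `p`-primary.
[cite: SerreGaloisCohomology1997, II §4.3 Prop. 12] -/
theorem subsingleton_continuousCohomology_galFixing_of_two_lt {p : ℕ} [Fact p.Prime]
    (E : IntermediateField F (AlgebraicClosure F))
    {M : Type u} [AddCommGroup M] [TopologicalSpace M] [DiscreteTopology M]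
    (ρ : ContinuousRep (galFixing F E) ℤ M) (hM : IsPrimaryTorsion p M) {q : ℕ} (hq : 2 < q) :
    Subsingleton (continuousCohomology q ρ.toTopRep) :=
  groupCdLE_two_of_isClosed F (galFixing F E) (isClosed_galFixing F E) p M ρ hM hq

end Local

end Literature.NumberTheory.GaloisRepresentations

end
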